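import Summits.QuantumFields.YangMills.Theorems.UnitScaleTiltProp7PinnedSliceOfExactCorrector
import Summits.QuantumFields.YangMills.Theorems.UnitScaleTiltProp7SmoothUntwistEnRows
import HarnessLib

/-!
# Route `UnitScaleTilt`, crux K1 «MinimiserStabilityRegPr» (stmt-QuantumFields-19200), route-R E′ path (α′): THE (E1-b) ↔ (E1-e) SOCKET — the pinned slice theorem (E1) per
# member∕competitor with the corrector rows (hK),(hK₂) REPLACED BY ONE EXISTENTIAL GAUGE ROW `hLrow` in the letters of ✓ `Prop7LinearCorrectorMember.exists_linCorr_member`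
# ((I) interpolant characterised incl. uniqueness ∧ (L) ∧ pinning ∧ solvability ∧ `p(L A) ≤ C·ℓ²‖D*_𝒰A‖` for every admissible weight), i.e. the shape ★routeR-w3's (E1-b) close
# delivers once it re-exports the characterisation; the transfer to EVERY characterised `(I, L)` (the knit's `hKrows`) is by uniqueness of the pinned biharmonic interpolant

Cell `ym3-torus`, width seat `ym3-torus-px13` (gen 3); SOCKET NOTE of 2026-08-29 00:2xZ (routeR-w3 g6's 00:12Z close exports `∃ I L, (L) ∧ pinning ∧ gauge row` without (I) —
inhabited by `I := id, L := 0`; this file fixes the consumer side: WITH (I) and solvability the row transfers).  THEOREMS ONLY (0 `def`, 0 `sorry`, 0 `instance`);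
`--supports stmt-QuantumFields-19200`, count-neutral.  YM₃ on T³ is a ladder rung (R3), not the Clay problem; nothing here claims the stub, the crux, d = 4 or the gap; (E1) is
NOT closed by this file — its remaining rows are DISPLAYED.

WHAT IS PROVED (ns `…Theorems.Prop7PinnedSliceOfLinCorrRow`; `T := torusT (F.P K) 0`, `𝒰 := fun κ z => unitsField (toUField W) ⟨z, κ⟩`, `ℓ := L^{K−n}`).
* §1 ★★★ `pinnedSlice_member_of_linCorrRow` — ✓ `pinnedSlice_member` with its letters `d, hd, cI, c₂, hKrows` replaced by `C ≥ 0` and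
  `hLrow : ∀ w (≤ dist to the centres, ≤ ℓ, ≥ 0), ∃ I L, (I) ∧ (L) ∧ pinning ∧ solvability ∧ ∀ A, max ‖L A‖ (max (ℓ‖D_𝒰(L A)‖) (ℓ‖w·D*_𝒰D_𝒰(L A)‖)) ≤ C·(ℓ²‖D*_𝒰A‖)`;
  windows `1800·C·s ≤ 1`, `(3C∕2)·1600·(7(3C∕2)s + s) ≤ 1∕2`; conclusion = the (E1) body VERBATIM with `sQ := 2s + 9Cs`.  INSIDE: the torus potential `d` (✓ `exists_torusPotential`)
  gives the admissible weight `min d ℓ`; for any `(I, L)` with (L), pinning and `I` biharmonic off the centres, `I φ` matches `φ` at the centres (pinning of `L(D_𝒰φ) = φ − Iφ`), so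
  `I φ = I′ φ` by (I)'s uniqueness clause and `L A = L′ A` through a common potential (solvability); the gauge row of `L′` then yields (hK) with `c_I := C` (two `Pi` norms) and
  (hK₂) with `c₂ := C` (`D*_𝒰((−I)•D_𝒰ψ) = (−I)•D*_𝒰D_𝒰ψ`, `‖−I‖ = 1`); `max (3C∕2) (max C C) = 3C∕2`.
* §2 ★★★ `pinnedSlice_of_untwistedStart_of_linCorrRow` — the same at the untwisted start ✓ `exists_untwistedStart_En_T3` (w1 g12): the (E1) conjunct for the competitor
  `(e^{iA₀}W)^u` modulo print's rows (1.36)₁₂, (1.72), frames ⊕ `hLrow` ⊕ windows.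
HONEST SCOPE.  Consumer-side socket algebra; no analytic estimate is proved here; `hLrow`'s inhabitant is ★routeR-w3's (E1-b) chain (✓ `linCorr_gauge_le_of_supplier_rows` ∘ member
rows) once exported with (I) and solvability (both held there as `hI`, `hsolv`).

References: T. Bałaban, CMP 102 (1985) 277–309 [Balaban1985Variational] (Prop. 7 p.299, (4)–(7) p.278, (141)–(143)); CMP 99 (1985) 389–434 [Balaban1985BackgroundPropagators]
((3.3) p.390, (3.8) p.392); CMP 99 (1985) 75–102 [Balaban1985RegularSpaces] ((1.36) p.82, (1.72) p.88); CMP 98 (1985) 17–51 [Balaban1985Averaging] ((21)–(23) p.21).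
-/

set_option autoImplicit false

noncomputable section

open scoped BigOperators Matrix.Norms.L2Operator Matrix
open NormedSpace

namespace Summit.QuantumFields.YangMills.Theorems.Prop7PinnedSliceOfLinCorrRow

open Literature.MathematicalPhysics.QuantumFieldTheory.Balaban1983to89
open Literature.MathematicalPhysics.QuantumFieldTheory.Balaban1983to89.T3ContinuumYM3Torus
open Literature.MathematicalPhysics.QuantumFieldTheory.Balaban1983to89.T3PrintedRegularMinimiser (regFibrePr)
open Literature.MathematicalPhysics.QuantumFieldTheory.Balaban1983to89.T3SectALandauChart (emb15)
open T4Continuum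
open MatrixLog (mlog)
open B9Eq39Adjoint (covD divB)
open B9TorusCalculus (torusT)
open B15DeterminingSets (embIter)
open B10Eq27TorusAxialLog (unitsField toUField)
open B5Eq118OneStroke (iterBlockOf)
open Summit.QuantumFields.YangMills.Theorems.Prop7TPrint (expHermField)
open Summit.QuantumFields.YangMills.Theorems.Prop7ExactCorrectorHNMember (exists_torusPotential)
open Summit.QuantumFields.YangMills.Theorems.Prop7SmoothUntwistEnRows (exists_untwistedStart_En_T3)
open Summit.QuantumFields.YangMills.Theorems.Prop7PinnedSliceOfExactCorrector (pinnedSlice_member)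

set_option maxHeartbeats 400000 in
/-- ★★★ **THE PINNED SLICE THEOREM (E1) PER MEMBER∕COMPETITOR WITH THE (E1-b) GAUGE-ROW SOCKET** — ✓ `pinnedSlice_member` with `hKrows` replaced by the existential,
characterised gauge row `hLrow` (✓ `exists_linCorr_member`'s letters); `sQ := 2s + 9Cs`.
[cite: Balaban1985Variational, Prop. 7 p.299, (141)-(143); Balaban1985BackgroundPropagators, (3.3) p.390, (3.8) p.392] -/
theorem pinnedSlice_member_of_linCorrRow (F : T3Family) {n K : ℕ} (h : n ≤ K) {e : ℝ} (he : 0 ≤ e)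
    (V : GaugeField (F.P n) 0 (Matrix.specialUnitaryGroup (Fin 2) ℂ)) (W W' X : GaugeField (F.P K) 0 (Matrix.specialUnitaryGroup (Fin 2) ℂ))
    -- the competitor's untwisted representative
    (hX : X ∈ regFibrePr F n K h e V) (hAX : wilsonAction4 W' = wilsonAction4 X)
    -- its chart rows
    {s : ℝ}
    (hE1 : ∀ (μ : Fin (F.P K).d) (y : Site (F.P K) 0), ‖((X ⟨y, μ⟩ * (W ⟨y, μ⟩)⁻¹ : Matrix.specialUnitaryGroup (Fin 2) ℂ) : Matrix (Fin 2) (Fin 2) ℂ) - 1‖ < 1)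
    (hEβ : ∀ (μ : Fin (F.P K).d) (y : Site (F.P K) 0),
      (F.L : ℝ) ^ (K - n) * ‖mlog ((X ⟨y, μ⟩ * (W ⟨y, μ⟩)⁻¹ : Matrix.specialUnitaryGroup (Fin 2) ℂ) : Matrix (Fin 2) (Fin 2) ℂ)‖ ≤ s)
    (hEdiv : ∀ x : Site (F.P K) 0, ((F.L : ℝ) ^ (K - n)) ^ 2 * ‖divB (torusT (F.P K) 0) (fun κ z => unitsField (toUField W) ⟨z, κ⟩)
      (fun μ y => mlog ((X ⟨y, μ⟩ * (W ⟨y, μ⟩)⁻¹ : Matrix.specialUnitaryGroup (Fin 2) ℂ) : Matrix (Fin 2) (Fin 2) ℂ)) x‖ ≤ s)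
    (hs40 : 40 * s ≤ (F.L : ℝ) ^ (K - n))
    -- the linear corrector with its (I)(L)(pinning)(solvability) characterisation and its GAUGE ROW, for every admissible weight `w`
    -- (= ✓ `Prop7LinearCorrectorMember.exists_linCorr_member`'s export VERBATIM ∧ the door's consequent at `q := ℓ²‖D*_𝒰·‖`: the (E1-b) socket)
    {C : ℝ} (hC : 0 ≤ C)
    (hLrow : ∀ (w : Site (F.P K) 0 → ℝ), (∀ (x : Site (F.P K) 0) (y : Site (F.P K) (K - n)), w x ≤ (Site.tdist x (embIter (K - n) y) : ℝ)) →
        (∀ x, w x ≤ (F.L : ℝ) ^ (K - n)) → (∀ x, 0 ≤ w x) →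
      ∃ (I : (Site (F.P K) 0 → Matrix (Fin 2) (Fin 2) ℂ) →+ (Site (F.P K) 0 → Matrix (Fin 2) (Fin 2) ℂ))
        (L : (Fin (F.P K).d → Site (F.P K) 0 → Matrix (Fin 2) (Fin 2) ℂ) →+ (Site (F.P K) 0 → Matrix (Fin 2) (Fin 2) ℂ)),
        -- (I) the pinned `Δ_W`-biharmonic interpolant, characterised
        (∀ φ, ((∀ y : Site (F.P K) (K - n), I φ (embIter (K - n) y) = φ (embIter (K - n) y)) ∧
            ∀ x : Site (F.P K) 0, x ∉ Set.range (embIter (K - n)) →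
              divB (torusT (F.P K) 0) (fun κ z => unitsField (toUField W) ⟨z, κ⟩)
                (fun μ => covD (torusT (F.P K) 0) (fun κ z => unitsField (toUField W) ⟨z, κ⟩) μ
                  (fun y => divB (torusT (F.P K) 0) (fun κ z => unitsField (toUField W) ⟨z, κ⟩)
                    (fun ν => covD (torusT (F.P K) 0) (fun κ z => unitsField (toUField W) ⟨z, κ⟩) ν (I φ)) y)) x = 0) ∧
          ∀ χ, (∀ y : Site (F.P K) (K - n), χ (embIter (K - n) y) = φ (embIter (K - n) y)) →
            (∀ x : Site (F.P K) 0, x ∉ Set.range (embIter (K - n)) →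
              divB (torusT (F.P K) 0) (fun κ z => unitsField (toUField W) ⟨z, κ⟩)
                (fun μ => covD (torusT (F.P K) 0) (fun κ z => unitsField (toUField W) ⟨z, κ⟩) μ
                  (fun y => divB (torusT (F.P K) 0) (fun κ z => unitsField (toUField W) ⟨z, κ⟩)
                    (fun ν => covD (torusT (F.P K) 0) (fun κ z => unitsField (toUField W) ⟨z, κ⟩) ν χ) y)) x = 0) → χ = I φ) ∧
        -- (L) the corrector for every potential
        (∀ A φ, (∀ x, divB (torusT (F.P K) 0) (fun κ z => unitsField (toUField W) ⟨z, κ⟩)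
              (fun μ => covD (torusT (F.P K) 0) (fun κ z => unitsField (toUField W) ⟨z, κ⟩) μ φ) x
            = divB (torusT (F.P K) 0) (fun κ z => unitsField (toUField W) ⟨z, κ⟩) A x) → L A = φ - I φ) ∧
        -- pinning
        (∀ (A) (y : Site (F.P K) (K - n)), L A (embIter (K - n) y) = 0) ∧
        -- solvability
        (∀ A, ∃ φ, (∀ x, divB (torusT (F.P K) 0) (fun κ z => unitsField (toUField W) ⟨z, κ⟩)
              (fun μ => covD (torusT (F.P K) 0) (fun κ z => unitsField (toUField W) ⟨z, κ⟩) μ φ) x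
            = divB (torusT (F.P K) 0) (fun κ z => unitsField (toUField W) ⟨z, κ⟩) A x) ∧ L A = φ - I φ) ∧
        ∀ A, max ‖L A‖ (max ((F.L : ℝ) ^ (K - n) * ‖(fun μ z => covD (torusT (F.P K) 0) (fun κ z => unitsField (toUField W) ⟨z, κ⟩) μ (L A) z)‖)
            ((F.L : ℝ) ^ (K - n) * ‖(fun x => ((w x : ℝ) : ℂ) • divB (torusT (F.P K) 0) (fun κ z => unitsField (toUField W) ⟨z, κ⟩)
              (fun μ => covD (torusT (F.P K) 0) (fun κ z => unitsField (toUField W) ⟨z, κ⟩) μ (L A)) x)‖))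
          ≤ C * (((F.L : ℝ) ^ (K - n)) ^ 2 * ‖(fun x => divB (torusT (F.P K) 0) (fun κ z => unitsField (toUField W) ⟨z, κ⟩) A x)‖))
    -- the windows
    (hwin1 : 1800 * C * s ≤ 1) (hwin2 : 3 / 2 * C * (400 * (1 + 3)) * (7 * (3 / 2 * C) * s + s) ≤ 1 / 2) :
    ∃ Y : GaugeField (F.P K) 0 (Matrix.specialUnitaryGroup (Fin 2) ℂ), Y ∈ regFibrePr F n K h e V ∧ wilsonAction4 W' = wilsonAction4 Y ∧
      (∀ b : PBond (F.P K) 0, ‖((Y b * (W b)⁻¹ : Matrix.specialUnitaryGroup (Fin 2) ℂ) : Matrix (Fin 2) (Fin 2) ℂ) - 1‖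
        ≤ (2 * s + 9 * C * s) * ((F.L : ℝ) ^ (K - n))⁻¹) ∧
      (∀ x : Site (F.P K) 0, x ∉ Set.range (embIter (K - n)) →
        divB (torusT (F.P K) 0) (fun κ z => unitsField (toUField W) ⟨z, κ⟩)
          (fun μ z => covD (torusT (F.P K) 0) (fun κ z => unitsField (toUField W) ⟨z, κ⟩) μ
            (fun y => divB (torusT (F.P K) 0) (fun κ z => unitsField (toUField W) ⟨z, κ⟩)
              (fun κ z => Complex.I • ((-Complex.I) • mlog ((Y ⟨z, κ⟩ * (W ⟨z, κ⟩)⁻¹ : Matrix.specialUnitaryGroup (Fin 2) ℂ) : Matrix (Fin 2) (Fin 2) ℂ))) y) z) x = 0) := by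
  -- letters and sizes
  set T : Fin (F.P K).d → Equiv.Perm (Site (F.P K) 0) := torusT (F.P K) 0 with hTdef
  set U : Fin (F.P K).d → Site (F.P K) 0 → (Matrix (Fin 2) (Fin 2) ℂ)ˣ := fun κ z => unitsField (toUField W) ⟨z, κ⟩ with hUdef
  set ℓ : ℝ := (F.L : ℝ) ^ (K - n) with hℓdef
  have hL1 : 1 ≤ F.L := le_of_lt F.hL.2
  have hℓ1 : (1 : ℝ) ≤ ℓ := by rw [hℓdef]; exact_mod_cast Nat.one_le_pow _ _ (by omega)
  have hℓ0 : (0 : ℝ) < ℓ := by linarith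
  -- the torus potential (✓ `exists_torusPotential`) and its capped weight `min d ℓ`
  obtain ⟨d, -, hdC, hdesc⟩ := exists_torusPotential (P := F.P K) (K - n)
  have hwC : ∀ (x : Site (F.P K) 0) (y : Site (F.P K) (K - n)), min (d x : ℝ) ℓ ≤ (Site.tdist x (embIter (K - n) y) : ℝ) :=
    fun x y => (min_le_left _ _).trans (by exact_mod_cast hdC x y)
  have hwℓ : ∀ x : Site (F.P K) 0, min (d x : ℝ) ℓ ≤ ℓ := fun x => min_le_right _ _
  have hw0 : ∀ x : Site (F.P K) 0, 0 ≤ min (d x : ℝ) ℓ := fun x => le_min (Nat.cast_nonneg _) hℓ0.le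
  obtain ⟨I', L', hI', hL'c, hL'p, hsolv', hrow'⟩ := hLrow (fun x => min (d x : ℝ) ℓ) hwC hwℓ hw0
  -- the knit's constant `C_L = max (3C∕2) (max C C) = 3C∕2`
  have hmax : max (3 / 2 * C) (max C C) = 3 / 2 * C := by rw [max_self]; exact max_eq_left (by linarith)
  have hwin1' : 1200 * max (3 / 2 * C) (max C C) * s ≤ 1 := by rw [hmax]; linarith
  have hwin2' : max (3 / 2 * C) (max C C) * (400 * (1 + 3)) * (7 * max (3 / 2 * C) (max C C) * s + s) ≤ 1 / 2 := by rw [hmax]; exact hwin2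
  have hres := pinnedSlice_member F h he V W W' X hX hAX hE1 hEβ hEdiv hs40 d hdesc hC hC ?hk hwin1' hwin2'
  case hk =>
    -- the rows (hK),(hK₂) for EVERY characterised `(I, L)`: `L = L'` by uniqueness of the pinned biharmonic interpolant, then the gauge row of `L'`
    intro I L hLc hLp hIb
    have hLL : ∀ A, L A = L' A := by
      intro A
      obtain ⟨φ, hφ, hL'A⟩ := hsolv' A
      have hmatch : ∀ y : Site (F.P K) (K - n), I φ (embIter (K - n) y) = φ (embIter (K - n) y) := by
        intro y
        have h1 : L (fun μ => covD T U μ φ) = φ - I φ := hLc (fun μ => covD T U μ φ) φ (fun x => rfl)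
        have h2 := hLp (fun μ => covD T U μ φ) y
        rw [h1, Pi.sub_apply, sub_eq_zero] at h2
        exact h2.symm
      have hIφ : I φ = I' φ := (hI' φ).2 (I φ) hmatch (hIb φ)
      rw [hLc A φ hφ, hL'A, hIφ]
    refine ⟨fun A μ x => ?_, fun A => ?_⟩
    · have hr := hrow' A
      rw [hLL A]
      have h1 : ‖covD T U μ (L' A) x‖ ≤ ‖(fun μ z => covD T U μ (L' A) z)‖ :=
        (norm_le_pi_norm (fun z => covD T U μ (L' A) z) x).trans (norm_le_pi_norm (fun μ z => covD T U μ (L' A) z) μ)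
      have h2 : ℓ * ‖(fun μ z => covD T U μ (L' A) z)‖ ≤ C * (ℓ ^ 2 * ‖fun x => divB T U A x‖) :=
        le_trans (le_trans (le_max_left _ _) (le_max_right _ _)) hr
      exact h1.trans (le_of_mul_le_mul_left (h2.trans_eq (by ring)) hℓ0)
    · have hr := hrow' A
      rw [hLL A]
      have hfun : (fun x => ((min (d x : ℝ) ℓ : ℝ) : ℂ) • divB T U (fun μ y => (-Complex.I) • covD T U μ (L' A) y) x)
          = (-Complex.I) • (fun x => ((min (d x : ℝ) ℓ : ℝ) : ℂ) • divB T U (fun μ => covD T U μ (L' A)) x) := by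
        funext x
        rw [Pi.smul_apply, B9Eq3117Current.divB_smul T U (-Complex.I) (fun μ => covD T U μ (L' A)) x, smul_comm]
      rw [hfun, norm_smul, norm_neg, Complex.norm_I, one_mul]
      have h2 : ℓ * ‖(fun x => ((min (d x : ℝ) ℓ : ℝ) : ℂ) • divB T U (fun μ => covD T U μ (L' A)) x)‖ ≤ C * (ℓ ^ 2 * ‖fun x => divB T U A x‖) :=
        le_trans (le_trans (le_max_right _ _) (le_max_right _ _)) hr
      exact le_of_mul_le_mul_left (h2.trans_eq (by ring)) hℓ0
  obtain ⟨Y, hY, hA, hsup, hSH⟩ := hres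
  exact ⟨Y, hY, hA, fun b => (hsup b).trans_eq (by rw [hmax]; ring), hSH⟩

/-- ★★★ **THE SAME FOR THE COMPETITOR `(e^{iA₀}W)^u` AT THE UNTWISTED START** — ✓ `exists_untwistedStart_En_T3` (w1 g12) ∘ §1: the (E1) conjunct modulo print's rows, the
(E1-b) socket `hLrow` and the windows; `sQ := 2s + 9Cs`.
[cite: Balaban1985Variational, Prop. 7 p.299; Balaban1985RegularSpaces, (1.36) p.82, (1.72) p.88; Balaban1985Averaging, (21)-(23) p.21] -/
theorem pinnedSlice_of_untwistedStart_of_linCorrRow (F : T3Family) {n K : ℕ} (h : n ≤ K) (hk1 : 1 ≤ K - n) {e s₀ s₁' σ a₀ a₁ c₀ c₁ : ℝ} (he : 0 ≤ e)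
    -- print's rows for the competitor `(e^{iA₀}W)^u`: ✓ `exists_untwistedStart_En_T3`'s hypotheses VERBATIM
    {V : GaugeField (F.P n) 0 (Matrix.specialUnitaryGroup (Fin 2) ℂ)} (W : GaugeField (F.P K) 0 (Matrix.specialUnitaryGroup (Fin 2) ℂ))
    (A₀ : PBond (F.P K) 0 → Matrix (Fin 2) (Fin 2) ℂ) (hA0 : ∀ b, (A₀ b).IsHermitian ∧ Matrix.trace (A₀ b) = 0)
    (hs₀ : ((((F.P K).L ^ (K - n) : ℕ)) : ℝ) * ‖(fun (μ : Fin (F.P K).d) (z : Site (F.P K) 0) => A₀ ⟨z, μ⟩)‖ ≤ s₀) (hs₀' : s₀ ≤ 1 / 64)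
    (hs₁ : ((((F.P K).L ^ (K - n) : ℕ)) : ℝ) ^ 2 * ‖(fun x => divB (torusT (F.P K) 0) (fun κ z => unitsField (toUField W) ⟨z, κ⟩) (fun μ z => A₀ ⟨z, μ⟩) x)‖ ≤ s₁')
    (u : GaugeTransf (F.P K) 0 (Matrix.specialUnitaryGroup (Fin 2) ℂ)) (hXu : GaugeField.gaugeAct u (emb15 W (expHermField A₀)) ∈ regFibrePr F n K h e V)
    (hσ : ∀ y : Site (F.P K) (K - n), dist1 (u (embIter (K - n) y)) ≤ σ) (hσ0 : σ ≤ 1 / 1024) (hσc : ((6 + 2 * c₀) * (2 * σ)) ≤ 1 / 256)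
    (Fr : Site (F.P K) (K - n) → Site (F.P K) 0 → (Matrix (Fin 2) (Fin 2) ℂ)ˣ)
    (hFr : ∀ y z, ‖(Fr y z : Matrix (Fin 2) (Fin 2) ℂ)‖ ≤ 1 ∧ ‖(((Fr y z)⁻¹ : (Matrix (Fin 2) (Fin 2) ℂ)ˣ) : Matrix (Fin 2) (Fin 2) ℂ)‖ ≤ 1) (hFr1 : ∀ y, Fr y (embIter (K - n) y) = 1)
    (ha₀ : 0 ≤ a₀) (ha₁ : 0 ≤ a₁) (hc₀ : ((((F.P K).L ^ (K - n) : ℕ)) : ℝ) * a₀ ≤ c₀) (hc₁ : ((((F.P K).L ^ (K - n) : ℕ)) : ℝ) ^ 2 * a₁ ≤ c₁)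
    (hA : ∀ (y : Site (F.P K) (K - n)) (z : Site (F.P K) 0), (∀ ν : Fin (F.P K).d, (y ν = (iterBlockOf (K - n) (fun κ => z κ - (((((F.P K).L ^ (K - n) - 1) / 2 : ℕ)) : ZMod ((F.P K).sitesPerDir 0)))) ν - 1 ∨ y ν = (iterBlockOf (K - n) (fun κ => z κ - (((((F.P K).L ^ (K - n) - 1) / 2 : ℕ)) : ZMod ((F.P K).sitesPerDir 0)))) ν ∨ y ν = (iterBlockOf (K - n) (fun κ => z κ - (((((F.P K).L ^ (K - n) - 1) / 2 : ℕ)) : ZMod ((F.P K).sitesPerDir 0)))) ν + 1 ∨ y ν = (iterBlockOf (K - n) (fun κ => z κ - (((((F.P K).L ^ (K - n) - 1) / 2 : ℕ)) : ZMod ((F.P K).sitesPerDir 0)))) ν + 2)) → ∀ μ : Fin (F.P K).d,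
      ‖(((Fr y z)⁻¹ * unitsField (toUField W) ⟨z, μ⟩ * Fr y (torusT (F.P K) 0 μ z) : (Matrix (Fin 2) (Fin 2) ℂ)ˣ) : Matrix (Fin 2) (Fin 2) ℂ) - 1‖ ≤ a₀
      ∧ ‖(((Fr y ((torusT (F.P K) 0 μ).symm z))⁻¹ * unitsField (toUField W) ⟨(torusT (F.P K) 0 μ).symm z, μ⟩ * Fr y z : (Matrix (Fin 2) (Fin 2) ℂ)ˣ) : Matrix (Fin 2) (Fin 2) ℂ) - 1‖ ≤ a₀
      ∧ ‖(((Fr y z)⁻¹ * unitsField (toUField W) ⟨z, μ⟩ * Fr y (torusT (F.P K) 0 μ z) : (Matrix (Fin 2) (Fin 2) ℂ)ˣ) : Matrix (Fin 2) (Fin 2) ℂ)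
          - (((Fr y ((torusT (F.P K) 0 μ).symm z))⁻¹ * unitsField (toUField W) ⟨(torusT (F.P K) 0 μ).symm z, μ⟩ * Fr y z : (Matrix (Fin 2) (Fin 2) ℂ)ˣ) : Matrix (Fin 2) (Fin 2) ℂ)‖ ≤ a₁)
    -- the linear corrector with its (I)(L)(pinning)(solvability) characterisation and its GAUGE ROW, for every admissible weight `w`
    -- (= ✓ `Prop7LinearCorrectorMember.exists_linCorr_member`'s export VERBATIM ∧ the door's consequent at `q := ℓ²‖D*_𝒰·‖`: the (E1-b) socket)
    {C : ℝ} (hC : 0 ≤ C)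
    (hLrow : ∀ (w : Site (F.P K) 0 → ℝ), (∀ (x : Site (F.P K) 0) (y : Site (F.P K) (K - n)), w x ≤ (Site.tdist x (embIter (K - n) y) : ℝ)) →
        (∀ x, w x ≤ (F.L : ℝ) ^ (K - n)) → (∀ x, 0 ≤ w x) →
      ∃ (I : (Site (F.P K) 0 → Matrix (Fin 2) (Fin 2) ℂ) →+ (Site (F.P K) 0 → Matrix (Fin 2) (Fin 2) ℂ))
        (L : (Fin (F.P K).d → Site (F.P K) 0 → Matrix (Fin 2) (Fin 2) ℂ) →+ (Site (F.P K) 0 → Matrix (Fin 2) (Fin 2) ℂ)),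
        -- (I) the pinned `Δ_W`-biharmonic interpolant, characterised
        (∀ φ, ((∀ y : Site (F.P K) (K - n), I φ (embIter (K - n) y) = φ (embIter (K - n) y)) ∧
            ∀ x : Site (F.P K) 0, x ∉ Set.range (embIter (K - n)) →
              divB (torusT (F.P K) 0) (fun κ z => unitsField (toUField W) ⟨z, κ⟩)
                (fun μ => covD (torusT (F.P K) 0) (fun κ z => unitsField (toUField W) ⟨z, κ⟩) μ
                  (fun y => divB (torusT (F.P K) 0) (fun κ z => unitsField (toUField W) ⟨z, κ⟩)
                    (fun ν => covD (torusT (F.P K) 0) (fun κ z => unitsField (toUField W) ⟨z, κ⟩) ν (I φ)) y)) x = 0) ∧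
          ∀ χ, (∀ y : Site (F.P K) (K - n), χ (embIter (K - n) y) = φ (embIter (K - n) y)) →
            (∀ x : Site (F.P K) 0, x ∉ Set.range (embIter (K - n)) →
              divB (torusT (F.P K) 0) (fun κ z => unitsField (toUField W) ⟨z, κ⟩)
                (fun μ => covD (torusT (F.P K) 0) (fun κ z => unitsField (toUField W) ⟨z, κ⟩) μ
                  (fun y => divB (torusT (F.P K) 0) (fun κ z => unitsField (toUField W) ⟨z, κ⟩)
                    (fun ν => covD (torusT (F.P K) 0) (fun κ z => unitsField (toUField W) ⟨z, κ⟩) ν χ) y)) x = 0) → χ = I φ) ∧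
        -- (L) the corrector for every potential
        (∀ A φ, (∀ x, divB (torusT (F.P K) 0) (fun κ z => unitsField (toUField W) ⟨z, κ⟩)
              (fun μ => covD (torusT (F.P K) 0) (fun κ z => unitsField (toUField W) ⟨z, κ⟩) μ φ) x
            = divB (torusT (F.P K) 0) (fun κ z => unitsField (toUField W) ⟨z, κ⟩) A x) → L A = φ - I φ) ∧
        -- pinning
        (∀ (A) (y : Site (F.P K) (K - n)), L A (embIter (K - n) y) = 0) ∧
        -- solvability
        (∀ A, ∃ φ, (∀ x, divB (torusT (F.P K) 0) (fun κ z => unitsField (toUField W) ⟨z, κ⟩)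
              (fun μ => covD (torusT (F.P K) 0) (fun κ z => unitsField (toUField W) ⟨z, κ⟩) μ φ) x
            = divB (torusT (F.P K) 0) (fun κ z => unitsField (toUField W) ⟨z, κ⟩) A x) ∧ L A = φ - I φ) ∧
        ∀ A, max ‖L A‖ (max ((F.L : ℝ) ^ (K - n) * ‖(fun μ z => covD (torusT (F.P K) 0) (fun κ z => unitsField (toUField W) ⟨z, κ⟩) μ (L A) z)‖)
            ((F.L : ℝ) ^ (K - n) * ‖(fun x => ((w x : ℝ) : ℂ) • divB (torusT (F.P K) 0) (fun κ z => unitsField (toUField W) ⟨z, κ⟩)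
              (fun μ => covD (torusT (F.P K) 0) (fun κ z => unitsField (toUField W) ⟨z, κ⟩) μ (L A)) x)‖))
          ≤ C * (((F.L : ℝ) ^ (K - n)) ^ 2 * ‖(fun x => divB (torusT (F.P K) 0) (fun κ z => unitsField (toUField W) ⟨z, κ⟩) A x)‖))
    -- any `s` dominating the two printed chart constants `S₁`, `S₂` of ✓ `exists_untwistedStart_En_T3`, windowed
    {s : ℝ} (hS₁ : (s₀ + (1 + 2 * s₀) * ((1 + 6 * σ) * ((6 + 2 * c₀) * (2 * σ)))) ≤ s)
    (hS₂ : (s₁' + ((F.P K).d : ℝ) * (((2 * (c₁ + 2 * c₀ ^ 2) + 24 * c₀ + 24) * (2 * σ)) + 9 * ((6 + 2 * c₀) * (2 * σ)) ^ 2 + 36 * σ * ((2 * (c₁ + 2 * c₀ ^ 2) + 24 * c₀ + 24) * (2 * σ)))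
      + ((F.P K).d : ℝ) * (6 * ((6 + 2 * c₀) * (2 * σ)) * s₀ + 4 * s₀ * ((1 + 6 * σ) * ((6 + 2 * c₀) * (2 * σ))))) ≤ s)
    (hs40 : 40 * s ≤ (F.L : ℝ) ^ (K - n))
    -- the windows
    (hwin1 : 1800 * C * s ≤ 1) (hwin2 : 3 / 2 * C * (400 * (1 + 3)) * (7 * (3 / 2 * C) * s + s) ≤ 1 / 2) :
    ∃ Y : GaugeField (F.P K) 0 (Matrix.specialUnitaryGroup (Fin 2) ℂ), Y ∈ regFibrePr F n K h e V ∧ wilsonAction4 (GaugeField.gaugeAct u (emb15 W (expHermField A₀))) = wilsonAction4 Y ∧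
      (∀ b : PBond (F.P K) 0, ‖((Y b * (W b)⁻¹ : Matrix.specialUnitaryGroup (Fin 2) ℂ) : Matrix (Fin 2) (Fin 2) ℂ) - 1‖
        ≤ (2 * s + 9 * C * s) * ((F.L : ℝ) ^ (K - n))⁻¹) ∧
      (∀ x : Site (F.P K) 0, x ∉ Set.range (embIter (K - n)) →
        divB (torusT (F.P K) 0) (fun κ z => unitsField (toUField W) ⟨z, κ⟩)
          (fun μ z => covD (torusT (F.P K) 0) (fun κ z => unitsField (toUField W) ⟨z, κ⟩) μ
            (fun y => divB (torusT (F.P K) 0) (fun κ z => unitsField (toUField W) ⟨z, κ⟩)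
              (fun κ z => Complex.I • ((-Complex.I) • mlog ((Y ⟨z, κ⟩ * (W ⟨z, κ⟩)⁻¹ : Matrix.specialUnitaryGroup (Fin 2) ℂ) : Matrix (Fin 2) (Fin 2) ℂ))) y) z) x = 0) := by
  obtain ⟨D, _, hX, hAX, _, hE1, hEβ, hEdiv⟩ :=
    exists_untwistedStart_En_T3 F h hk1 he W A₀ hA0 hs₀ hs₀' hs₁ u hXu hσ hσ0 hσc Fr hFr hFr1 ha₀ ha₁ hc₀ hc₁ hA
  exact pinnedSlice_member_of_linCorrRow F h he V W _ _ hX hAX hE1 (fun μ y => (hEβ μ y).trans hS₁) (fun x => (hEdiv x).trans hS₂) hs40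
    hC hLrow hwin1 hwin2

end Summit.QuantumFields.YangMills.Theorems.Prop7PinnedSliceOfLinCorrRow

end
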